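import Literature.AlgebraicGeometry.Frobenioids.BaseCategoryTheoreticitySchemaNegativeThm34
import HarnessLib

/-!
# Frobenioids I, Theorem 3.4 (iv), (v): the typed SCHEMATA `Thm34iv`, `Thm34v` of
# `BaseCategoryTheoreticity.lean` have FALSE universal closures over the bare operations interface

Mochizuki, *The geometry of Frobenioids I: the general theory*, Kyushu J. Math. **62** (2008)
293–400, Thm. 3.4 (iv) p. 62 l. 36 – p. 63 l. 4, (v) p. 63 ll. 22–37 [cite: MochizukiFrdI2008, Thm. 3.4 (iv) p.63].

PROOF-ONLY companion (no definitions, no instances) of `BaseCategoryTheoreticity.lean` (seat abc-iut-L1-t3),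
written for the abc-iut cell's FROZEN FACT-LIST rows F-0905 `PreFrobenioidData.Thm34iv` and F-0907
`PreFrobenioidData.Thm34v` (seat abc-iut-f-019; cell rule R5). Both declarations are conclusion predicates in
the bare operations `S_i : PreFrobenioidData C_i D_i` (the data `(Base, Φ, Div, deg_Fr)` of Def. 1.1 (iv)
WITHOUT the Frobenioid axioms of Def. 1.3) and an arbitrary equivalence `Ψ`; the paper asserts them for
FROBENIOIDS, and in that form they are THEOREMS of the tree: `FrdI.Thm34iv_holds` / `FrdI.Thm34v_holds`
(seat abc-iut-L1-t11, `EquivalencePreStepsFSMFF2008Assembly.lean`, F-0713 / F-0714; instance one-liners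
`FrdI.thm34iv_ofFunctor` / `FrdI.thm34v_ofFunctor`, `BaseCategoryTheoreticityInstancesClosed.lean`). Over the
bare interface the universal closures are FALSE — kernel witnesses on seat abc-iut-f-018's junk carrier
`B(N_{≥1}) = SingleObj ℕ+` (`SchemaNegativeThm34.exists_ops`: constant base functor, constant divisor monoid
`ℕ` with identity pull-backs, `Div ≡ 0`, `deg_Fr = e`; of standard type with (b) vacuous since `Φ ≠ 0`):

* `PreFrobenioidData.not_forall_thm34iv` (F-0905) — `Ψ = 𝟭`, `deg_Fr = id` versus `deg_Fr = n²` over the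
  one-morphism base `Discrete PUnit` (slim, hence Frobenius-slim, (c)): the clause "`Ψ^{ℕ≥1}` is the identity"
  (`PreservesDegFr`) fails at the arrow `2`;
* `PreFrobenioidData.not_forall_thm34v` (F-0907) — `Ψ = 𝟭`, the same operations over the slim bases
  `D₁ = Discrete PUnit` and `D₂ = Discrete Bool` (constant at `true`): no `Ψ^Base : D₁ ⥤ D₂` is an
  equivalence (`false ≇ true`), so the `1`-unique base square of (v) does not exist.

A refuted closure is a statement about the typing, not about the paper; no statement of the paper is restated
or strengthened; no side is taken on [IUTchIII] Cor. 3.12.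
-/

namespace Literature.AlgebraicGeometry.Frobenioids

open CategoryTheory

namespace PreFrobenioidData

open SchemaNegativeThm34

/-- A discrete category is slim (thin: every slice-forgetful functor is rigid) …
[cite: MochizukiFrdI2008, §0 p.14] -/
theorem isSlim_discrete (α : Type) : IsSlim (Discrete α) :=
  ⟨fun _ β => by
    ext X
    exact Subsingleton.elim _ _⟩

/-- … and of FSM-type, hence of FSMFF-type (every arrow is invertible). [cite: MochizukiFrdI2008, §0 p.18] -/
theorem isOfFSMFFType_discrete (α : Type) : IsOfFSMFFType (Discrete α) :=
  (⟨fun _ _ => inferInstance⟩ : IsOfFSMType (Discrete α)).isOfFSMFFType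

/-- **The universal closure of the typed `PreFrobenioidData.Thm34iv` is false** (F-0905): over the bare
operations interface, with `Ψ = 𝟭` on `B(N_{≥1})` over the one-morphism base (slim, hence Frobenius-slim —
hypothesis (c)) and the junk operations `(Φ = ℕ, Div = 0, deg_Fr = id)` vs `(Φ = ℕ, Div = 0, deg_Fr = n²)`
(both of standard type, `HypB` vacuous), the clause `PreservesDegFr` of (iv) fails: `deg_Fr(𝟭 2) = 4 ≠ 2`.
The INSTANCE FORM over Frobenioids is the closed fact `FrdI.Thm34iv_holds` (F-0713).
[cite: MochizukiFrdI2008, Thm. 3.4 (iv) p.63] -/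
theorem not_forall_thm34iv :
    ¬ ∀ {C₁ : Type} [Category.{0} C₁] {D₁ : Type} [Category.{0} D₁]
        {C₂ : Type} [Category.{0} C₂] {D₂ : Type} [Category.{0} D₂]
        (S₁ : PreFrobenioidData.{0} C₁ D₁) (S₂ : PreFrobenioidData.{0} C₂ D₂) (Ψ : C₁ ≌ C₂),
        S₁.Thm34iv S₂ Ψ := by
  intro h
  have hD : IsOfFSMFFType (Discrete PUnit.{1}) := isOfFSMFFType_discrete PUnit
  have hfs : IsFrobeniusSlim (Discrete PUnit.{1}) := (isSlim_discrete PUnit).isFrobeniusSlim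
  have ha : ∃ a : Multiplicative ℕ, a ≠ 1 := ⟨Multiplicative.ofAdd 1, by simp⟩
  obtain ⟨S₁, hdeg₁, hlin₁, hdiv₁, hbase₁, -, hnd₁, -, hM₁⟩ :=
    exists_ops (⟨⟨⟩⟩ : Discrete PUnit.{1}) (Multiplicative ℕ) (MonoidHom.id ℕ+) fun _ h => h
  obtain ⟨S₂, hdeg₂, hlin₂, hdiv₂, hbase₂, -, hnd₂, -, hM₂⟩ :=
    exists_ops (⟨⟨⟩⟩ : Discrete PUnit.{1}) (Multiplicative ℕ) (powMonoidHom 2) powMonoidHom_two_eq_one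
  obtain ⟨-, -, hdeg⟩ := h S₁ S₂ CategoryTheory.Equivalence.refl
    (isOfStandardType S₁ hlin₁ hdiv₁ hbase₁ (hM₁ ha) hnd₁ hD)
    (isOfStandardType S₂ hlin₂ hdiv₂ hbase₂ (hM₂ ha) hnd₂ hD) (hypB S₁ (hM₁ ha) S₂ _) hfs hfs
  -- `deg_Fr₂(𝟭 2) = deg_Fr₁(2)`, i.e. `2² = 2`
  have key : S₂.degFr (show SingleObj.star ℕ+ ⟶ SingleObj.star ℕ+ from (2 : ℕ+)) =
      S₁.degFr (show SingleObj.star ℕ+ ⟶ SingleObj.star ℕ+ from (2 : ℕ+)) :=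
    hdeg (A := SingleObj.star ℕ+) (B := SingleObj.star ℕ+) (2 : ℕ+)
  rw [hdeg₂, hdeg₁] at key
  have k2 := congrArg PNat.val key
  simp at k2

/-- **The universal closure of the typed `PreFrobenioidData.Thm34v` is false** (F-0907): over the bare
operations interface, with `Ψ = 𝟭` on `B(N_{≥1})` and the junk operations `(Φ = ℕ, Div = 0, deg_Fr = id)` over
the SLIM bases `D₁ = Discrete PUnit` (constant at its point) and `D₂ = Discrete Bool` (constant at `true`) — both
of standard type, `HypB` vacuous, (c) slim — the conclusion "`Ψ^Base : D₁ ⥲ D₂`" of (v) fails: an equivalence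
`Discrete PUnit ⥤ Discrete Bool` would make `false ≅ true`. The INSTANCE FORM over Frobenioids is the closed
fact `FrdI.Thm34v_holds` (F-0714). [cite: MochizukiFrdI2008, Thm. 3.4 (v) p.63] -/
theorem not_forall_thm34v :
    ¬ ∀ {C₁ : Type} [Category.{0} C₁] {D₁ : Type} [Category.{0} D₁]
        {C₂ : Type} [Category.{0} C₂] {D₂ : Type} [Category.{0} D₂]
        (S₁ : PreFrobenioidData.{0} C₁ D₁) (S₂ : PreFrobenioidData.{0} C₂ D₂) (Ψ : C₁ ≌ C₂),
        S₁.Thm34v S₂ Ψ := by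
  intro h
  have ha : ∃ a : Multiplicative ℕ, a ≠ 1 := ⟨Multiplicative.ofAdd 1, by simp⟩
  obtain ⟨S₁, -, hlin₁, hdiv₁, hbase₁, -, hnd₁, -, hM₁⟩ :=
    exists_ops (⟨⟨⟩⟩ : Discrete PUnit.{1}) (Multiplicative ℕ) (MonoidHom.id ℕ+) fun _ h => h
  obtain ⟨S₂, -, hlin₂, hdiv₂, hbase₂, -, hnd₂, -, hM₂⟩ :=
    exists_ops (⟨true⟩ : Discrete Bool) (Multiplicative ℕ) (MonoidHom.id ℕ+) fun _ h => h
  obtain ⟨-, -, ΨBase, ⟨hequiv, -, -⟩, -⟩ := h S₁ S₂ CategoryTheory.Equivalence.refl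
    (isOfStandardType S₁ hlin₁ hdiv₁ hbase₁ (hM₁ ha) hnd₁ (isOfFSMFFType_discrete PUnit))
    (isOfStandardType S₂ hlin₂ hdiv₂ hbase₂ (hM₂ ha) hnd₂ (isOfFSMFFType_discrete Bool))
    (hypB S₁ (hM₁ ha) S₂ _) (isSlim_discrete PUnit) (isSlim_discrete Bool)
  -- an equivalence `Discrete PUnit ⥤ Discrete Bool` is essentially surjective: `false ≅ ΨBase pt ≅ true`
  have e : (⟨false⟩ : Discrete Bool) ≅ ⟨true⟩ :=
    (ΨBase.objObjPreimageIso ⟨false⟩).symm ≪≫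
      eqToIso (by rcases ΨBase.objPreimage ⟨false⟩ with ⟨⟨⟩⟩; rcases ΨBase.objPreimage ⟨true⟩ with ⟨⟨⟩⟩; rfl) ≪≫
      ΨBase.objObjPreimageIso ⟨true⟩
  exact Bool.false_ne_true (congrArg Discrete.as (Discrete.ext (Discrete.eq_of_hom e.hom)))

end PreFrobenioidData

end Literature.AlgebraicGeometry.Frobenioids
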